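import Literature.MathematicalPhysics.QuantumFieldTheory.Balaban1983to89.B7Prop3GeneralLinearBound
import Literature.MathematicalPhysics.QuantumFieldTheory.Balaban1983to89.B9Eq315QTorus

/-!
# `Balaban1983to89.B9Eq315QLipschitz` — T. Bałaban, *Propagators for lattice gauge theories in a background field*, Commun. Math. Phys.
# **99** (1985) 389–434 [Balaban1985BackgroundPropagators] (3.78)–(3.79) p. 406 (with (3.15) p. 393 and Thm 3.11 p. 416), and
# [Balaban1985Averaging] (124)–(126) p. 36: THE ONE-STEP VECTOR AVERAGING `Q(U)` IS LIPSCHITZ IN ITS BACKGROUND AT `U = 1` —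
# `‖Q(U)A − Q(1)A‖ ≤ O(1)·sup_b‖U(b) − 1‖·sup_b‖A(b)‖` with `O(1) = 102(d+1)²L` (print: «depends only on d and L»), on `ℤ^d`
# (`B7Prop3GeneralLinear.linQcov`), on the torus (`B9Eq315QTorus.QtorusLin`) and on the NE9 chain's weighted `L²` carriers (`QtorusW`)

statement-level skeleton of published theorems with citation tags; proofs where landed; nothing here is a claim
about the Yang–Mills mass gap

CITATION HEADER (lean-in-tree rule 2026-08-18).  Audit cell `pub-balaban`, sub-cell `t4`, NE9 crux team (2): LEAF PROVER 04
(`b2b-balaban-t4-ne9-formalise-leaf-04` gen 68) on the NE9 BINDER-row owner's OFFER O-ne9p1-g80-1 (journal `CLAIMS.log` l.37590, target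
«(δ_Q) the Q-Lipschitz letter from [B7] (124) for `QtorusW`»; TAKE l.37668).  Sources: [B9] = [Balaban1985BackgroundPropagators] (journal page =
PDF page + 388), p. 406 read by this seat (2026-08-22) in the held text `paper:balaban1985-cmp99-background-propagators`; [B7] = [Balaban1985Averaging]
(124)–(126) p. 36 through the verbatim quotations of `B7Prop3GeneralLinearBound` / `B7Prop3GeneralLinear` (b07 / NE7c lineages).
Companions (REUSED BY NAME, none modified): `B7Prop3GeneralLinearBound.norm_linQcov_sub_main_le` ((126): the linear part minus `L`·(125) is
`50(d+1)·ε·L·|A|` for `ε`-regular block loops), `B7Prop3GeneralLinear` (`linQcov`, `Q0cov`, `linQcov_one_left`), `B7Prop3Flat` (`linQ_eq_smul_Q0form`),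
`B7Prop3GeneralRotated` (`tsum`, `norm_tsum_le`), `B7Prop1Explicit` (`hol`, `Wcx`, `U1`), `B9Eq315QTorus` (`perCfg`, `QtorusLin`, `QtorusW`), `B9Eq311L2Pairing.WL2`.

THE PRINT (verbatim).  [B9] p. 406: *«Finally we consider the averaging operator Q(U). … It follows from the explicit formula (124) [5] that
the averaging operator Q(exp iB V) is an analytic function of B, for B sufficiently small. Moreover this formula implies easily that
Q(exp(iB)V) = Q(V) + F₂(B) and |F₂(B)B′| ≤ O(1) sup|B| Q″|B′| (3.79) where the averages Q″, Q‴_j were introduced in [5] by the formulas (140),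
(141). The constant O(1) above depends only on d and L.»* (text layer p0018 L16–L18; v1.3 DOCFIX: earlier versions printed «sup|B| sup|B′|» and dropped
the `Q″` clause — ne9-leaf-06 g62 X1 ∕ ne9-leaf-01 g77 X50 on the general-base twin `B9Eq379QLipschitzGeneral`; `Q″` is [B7]'s two-block average (140),
`(Q″|B′|)_c ≤ 2d·sup|B′|`, so the sup-currency statements below are an honestly WEAKER reading of (3.79)).  p. 407, (3.82):
*«… + F₂*(A)aQ(U) + Q*(U)aF₂(A) + F₂*(A)aF₂(A) = Δ_a(U) − V₃(A) − P₁(A) − P₂(A).»*  p. 416 (Thm 3.11): *«by (3.86) we get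
G_□(e^{iηA}) = G_□(1)(I − V(A)G_□(1))⁻¹ … hence … positivity of G_□»*.  [B7] p. 36 (as quoted in `B7Prop3GeneralLinearBound`): *«The remaining
terms are small because the functions g(−z), g⁻¹(z), e^{iz} are equal to 1 for z = 0, so the operators occurring in these terms can be
estimated by O(L²α₀) … (Q₀A)_c = (Q_{V₀}A)_c = Σ_{x∈B(c₋)} L^{−(d+1)}(R_{0,c₋}A)([x, x′]), (125) and it has an estimate |(Q₀A)_c| ≤ |A|»*;
p. 39 (read by this seat in the held text `paper:balaban1985-cmp98-averaging`): *«The linear part … (124) … is a sum of the main term Q_{V₀}A given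
by (125) and a remainder which we will denote by Q″(V₀)A. From (124) it is clear that we have the inequalities |Q_{V₀}A| ≤ Q|A|,
|Q″(V₀)A| ≤ C₁L²α₀Q″|A|, (139) … (Q″A)_c = Σ_{b⊂B(c₋)∪B(c₊)} L^{−d}|A_b| (140) … The constant C₁ depends on d and L.»*

WHY THIS FILE (cell context).  The NE9 BINDER-row owner's planned junction `B9Thm311SmallFieldCoercivity` ([B9] Thm 3.11's second half at a
FIXED lattice: the `hγ` coercivity of `Support/NE9CurChartOfBackground.cur_chart_exists_of_principal_coercive` at every background near `1`)
assembles the DISPLAYED closeness `hnear` of `B5Eq172FlatCoercivity.exists_coercive_principal_of_near_flat` from three parts ((3.82): `D`-part,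
`R`-part, `Q`-part); the `Q`-part needs ONE letter — `‖Q(U)x − Q(1)x‖ ≤ δ_Q‖x‖` for the chain's `QtorusW`, with `δ_Q → 0` as `U → 1`.  This
file PROVES that letter: print's `F₂` of (3.79) at `V = 1`, with the `O(1)` explicit.

WHAT IS PROVED (sorry-free; no `Prop` placeholder; no new definition; hypotheses = the displayed `U1` / regularity / closeness / bound letters).
* §1 `norm_hol_sub_one_le` — `‖V(Γ) − 1‖ ≤ |Γ|·ε_U` for a `U1` background with `‖V(b) − 1‖ ≤ ε_U` ((9), telescoping as on p. 25);
  **`norm_Wcx_sub_one_le`** — the block loops (42) are `2(d+1)L·ε_U`-close to `1`.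
* §2 `norm_tsum_sub_asum_le` — the rotated functional (58) against the abelian one: `‖(R_{0,y}A)(Γ) − A(Γ)‖ ≤ |Γ|(|Γ|+1)·ε_U·|A|`.
* §3 **`norm_Q0cov_sub_Q0form_le`** — the main term (125) against the flat one: `‖(Q₀(V₀)A)_c − (Q₀(1)A)_c‖ ≤ 2(d+1)L·ε_U·|A|`.
* §4 `linQcov_one_eq_smul_Q0form` (at `V₀ = 1` the linear part IS `L`·(125)); **`norm_linQcov_sub_flat_le`** — TWO letters: `ε`-regular loops
  (`ε ≤ 1∕8`) and `ε_U`-close bonds give `‖L(Q(V₀)A)_c − L(Q(1)A)_c‖ ≤ (50(d+1)ε + 2(d+1)Lε_U)·L·|A|`; **`norm_linQcov_sub_flat_le_of_bonds`** —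
  ONE letter: with the `α`-regularity (`α ≤ 1∕64`) that `linQAt`/`QtorusLin` display anyway, the loop letter is taken `min(α, 2(d+1)Lε_U)`, whence
  `≤ 102(d+1)²·L·ε_U·(L·|A|)` for EVERY `ε_U ≥ 0` bounding `‖V₀(b) − 1‖` (no smallness of `ε_U`).
* §5 **`norm_QtorusLin_sub_flat_le`** — on the torus `TSite d (L·m)`: `‖(Q(U)A)(c) − (Q(1)A)(c)‖ ≤ 102(d+1)²·L·ε_U·sup_b‖A(b)‖` (periodic
  extensions; `QtorusLin_apply` = `L⁻¹ •` «L(Q(Ũ)Ã)_c»; regularity letters on either side arbitrary — the value does not depend on them).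
* §6 `norm_apply_le_of_WL2`, `norm_WL2_le_of_pointwise` (weighted-`L²` ↔ pointwise on a finite carrier); **`norm_QtorusW_sub_flat_le`** — THE
  `δ_Q`-LETTER: `‖QtorusW φ U f − QtorusW φ 1 f‖ ≤ M_φ′·M_φ·√(c₁·|Bond(T^{(1)})|∕c₀)·102(d+1)²L·ε_U·‖f‖` under the displayed fibre letters
  `‖φw‖ ≤ M_φ‖w‖`, `‖φ⁻¹X‖ ≤ M_φ′‖X‖`.
MODEL / DECLARED READINGS.  (M1) as `B9Eq315QTorus`: torus `TSite d (L·m)`, periodic extension to `ℤ^d`, `U1` backgrounds (`‖U(b)‖, ‖U(b)⁻¹‖ ≤ 1`),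
one averaging level, `𝔸` a complete normed `ℂ`-algebra with `‖1‖ = 1`; `ε_U` is ANY bound of `sup_b ‖U(b) − 1‖` (print's `sup|B|` for
`U = e^{iB}`, up to the exponential series — not converted here).  (M2) print's (3.79) is at a general `V` (`Q(e^{iB}V) − Q(V)`); proved
here at `V = 1` only (the tree's (126) controls the defect brackets of (124) against the main term AT THE SAME background; a general-`V`
comparison of the brackets is not in the tree).  (M3) constants: `102(d+1)²L` (sup-norm, per unit `|A|`), resp. `× M_φ′M_φ√(c₁|Bond(T^{(1)})|∕c₀)`
on the `L²` carriers — admissible witnesses of print's «O(1) … depends only on d and L» at a fixed lattice; NOT optimal, NOT uniform in the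
volume `m` on the `L²` carriers (the crude `sup ≤ L²∕√c₀`, `L² ≤ √(c₁·card)·sup` comparison); uniformity in the volume = (3.83)'s semi-locality, not here.
HONEST SCOPE.  A finite-lattice continuity estimate assembled from the tree's (124)–(126) machinery; [B7] Prop. 3 (analyticity, (123)) NOT asserted;
nothing of [B9] Thm 3.11 / (3.85)–(3.86) asserted; one displayed letter of the owner's planned `exists_coercive_principal_of_small_field`, NOT
that theorem; NOT summit progress (cell pub-balaban: NE9 NOT PRINTED / NOT PROVED; spine PROVED 0/9; rung (B)+1 on a finite T⁴ — NOT infinite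
volume, NOT mass gap, NOT Clay).  NEW file importing `B7Prop3GeneralLinearBound` and `B9Eq315QTorus`; nothing of the b07 / NE7c / NE9-owner
lineages' files is modified.  Net new unproved facts: 0.
-/

noncomputable section

open scoped BigOperators

namespace Literature.MathematicalPhysics.QuantumFieldTheory.Balaban1983to89.B9Eq315QLipschitz

open B7Prop1Explicit B7Prop3Flat B7Prop3GeneralRotated B7Prop3GeneralLinear B7Prop3GeneralLinearBound
open B7Eq78Linearization (conjR conjR_apply conjR_sub conjR_one)

-- `Site` alone would resolve to the torus sites of `Setup.lean`; re-export the `ℤ^d` sites of `B7Prop1Explicit`.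
export B7Prop1Explicit (Site)

variable {d : ℕ} {𝔸 : Type*} [NormedRing 𝔸] [NormOneClass 𝔸]

/-! ## §1 Products of near-identity bond variables: `‖V(Γ) − 1‖ ≤ |Γ|·ε_U` -/

section Holonomy

variable {V : Site d → Fin d → 𝔸ˣ} (hV : ∀ x κ, V x κ ∈ U1 𝔸) {εU : ℝ} (hU : ∀ x κ, ‖(V x κ : 𝔸) - 1‖ ≤ εU)

include hV hU in
/-- One letter of (9): `‖V(b)^{±1} − 1‖ ≤ ε_U` (for the reversed orientation `U(−b) = U(b)⁻¹` and `‖u⁻¹ − 1‖ ≤ ‖u − 1‖` on `U1`).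
[cite: Balaban1985Averaging, (9) p.18] -/
theorem norm_stepHol_sub_one_le (x : Site d) (l : Letter d) : ‖((stepHol V x l : 𝔸ˣ) : 𝔸) - 1‖ ≤ εU := by
  unfold stepHol; split_ifs
  exacts [hU _ _, (norm_inv_sub_one_le (hV _ _)).trans (hU _ _)]

omit [NormOneClass 𝔸] in
/-- `‖XY − 1‖ ≤ ‖X − 1‖ + ‖Y − 1‖` when `‖Y‖ ≤ 1` (`XY − 1 = (X − 1)Y + (Y − 1)`). [folklore] -/
private theorem norm_mul_sub_one_le_add {X Y : 𝔸} (hY : ‖Y‖ ≤ 1) : ‖X * Y - 1‖ ≤ ‖X - 1‖ + ‖Y - 1‖ := by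
  rw [show X * Y - 1 = (X - 1) * Y + (Y - 1) by noncomm_ring]
  exact (norm_add_le _ _).trans (add_le_add ((norm_mul_le _ _).trans (mul_le_of_le_one_right (norm_nonneg _) hY)) le_rfl)

include hV hU in
/-- **`‖V(Γ) − 1‖ ≤ |Γ|·ε_U`**: the parallel transport (9) `V(Γ) = V(b₁)⋯V(b_n)` along a word of `|Γ|` bonds of a `U1` background whose bond
variables are `ε_U`-close to `1` is `|Γ|ε_U`-close to `1` (telescoping; the mechanism of p. 25 l. 3 «|V_{0,b} − 1| < |b₋ − y|α₀»).
[cite: Balaban1985Averaging, (9) p.18, p.25] -/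
theorem norm_hol_sub_one_le : ∀ (x : Site d) (w : List (Letter d)), ‖((hol V x w : 𝔸ˣ) : 𝔸) - 1‖ ≤ w.length * εU
  | x, [] => by simp
  | x, l :: w => by
    rw [hol_cons, Units.val_mul, List.length_cons, Nat.cast_succ, add_mul, one_mul, add_comm ((w.length : ℝ) * εU)]
    exact (norm_mul_sub_one_le_add (hol_mem hV _ w).1).trans
      (add_le_add (norm_stepHol_sub_one_le hV hU x l) (norm_hol_sub_one_le (x + l.vec) w))

include hV hU in
/-- **The block loops are `2(d+1)L·ε_U`-close to `1`**: `W_{c,x}(V) = V(Γ_{c,x} ∪ (−c))` is the holonomy of a loop of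
`2|x − c₋|₁ + 2L ≤ 2(d+1)L` bonds. [cite: Balaban1985Averaging, (42) p.23, (14) p.19] -/
theorem norm_Wcx_sub_one_le (L : ℕ) (q : Site d) (κ : Fin d) (r : Fin d → Fin L) (hεU : 0 ≤ εU) :
    ‖((Wcx L V q κ (boxVec L r) : 𝔸ˣ) : 𝔸) - 1‖ ≤ 2 * (d + 1) * L * εU := by
  rw [Wcx_eq_hol_loop]
  refine (norm_hol_sub_one_le hV hU q _).trans ?_
  rw [List.length_append, length_gammaWord, length_seg]
  have h1 : (l1 (boxVec L r) : ℝ) ≤ d * L := by exact_mod_cast l1_boxVec_le L r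
  have h2 : (((-(L : ℤ)).natAbs : ℕ) : ℝ) = L := by simp
  push_cast
  rw [h2]
  nlinarith

end Holonomy

/-! ## §2 The rotated functional against the abelian one: `‖(R_{0,y}A)(Γ) − A(Γ)‖ ≤ |Γ|(|Γ|+1)·ε_U·|A|` -/

section Rotated

variable {V : Site d → Fin d → 𝔸ˣ} (hV : ∀ x κ, V x κ ∈ U1 𝔸) {εU : ℝ} (hU : ∀ x κ, ‖(V x κ : 𝔸) - 1‖ ≤ εU)
  {A : Site d → Fin d → 𝔸} {a : ℝ} (hA : ∀ x κ, ‖A x κ‖ ≤ a)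

include hV hU hA in
/-- One letter: `‖tstep V A x l − stepA A x l‖ ≤ 2ε_U·|A|` (zero for a forward bond; `‖R(u)Z − Z‖ ≤ 2‖u − 1‖‖Z‖` for a reversed one).
[cite: Balaban1985Averaging, (58) p.27, (124)–(126) p.36] -/
theorem norm_tstep_sub_stepA_le (x : Site d) (l : Letter d) : ‖tstep V A x l - stepA A x l‖ ≤ 2 * εU * a := by
  have hε0 : 0 ≤ εU := (norm_nonneg _).trans (hU x l.1)
  have ha0 : 0 ≤ a := (norm_nonneg _).trans (hA x l.1)
  unfold tstep stepA
  split_ifs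
  · rw [sub_self, norm_zero]; positivity
  · rw [neg_sub_neg, norm_sub_rev]
    exact (norm_conjR_sub_self_le (stepHol_mem hV x l) (norm_stepHol_sub_one_le hV hU x l) _).trans
      (mul_le_mul_of_nonneg_left (hA _ _) (by positivity))

include hV hU hA in
/-- **`‖(R_{0,y}A)(Γ) − A(Γ)‖ ≤ |Γ|(|Γ|+1)·ε_U·|A|`**: the rotations `R(V(Γ_{y,b₋}))` of (58) are products of `≤ |Γ|` bond variables
`ε_U`-close to `1`, and `‖R(u)Z − Z‖ ≤ 2‖u − 1‖‖Z‖`. [cite: Balaban1985Averaging, (58) p.27, (125)–(126) p.36] -/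
theorem norm_tsum_sub_asum_le :
    ∀ (x : Site d) (w : List (Letter d)), ‖tsum V A x w - asum A x w‖ ≤ w.length * (w.length + 1) * εU * a
  | x, [] => by simp
  | x, l :: w => by
    have hε0 : 0 ≤ εU := (norm_nonneg _).trans (hU x l.1)
    have ha0 : 0 ≤ a := (norm_nonneg _).trans (hA x l.1)
    have ih := norm_tsum_sub_asum_le (x + l.vec) w
    have h1 := norm_tstep_sub_stepA_le hV hU hA x l
    have h2 : ‖conjR (stepHol V x l) (tsum V A (x + l.vec) w) - tsum V A (x + l.vec) w‖ ≤ 2 * εU * (w.length * a) :=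
      (norm_conjR_sub_self_le (stepHol_mem hV x l) (norm_stepHol_sub_one_le hV hU x l) _).trans
        (mul_le_mul_of_nonneg_left (norm_tsum_le hV hA _ w) (by positivity))
    have hsplit : tsum V A x (l :: w) - asum A x (l :: w)
        = (tstep V A x l - stepA A x l)
          + ((conjR (stepHol V x l) (tsum V A (x + l.vec) w) - tsum V A (x + l.vec) w)
            + (tsum V A (x + l.vec) w - asum A (x + l.vec) w)) := by
      rw [tsum_cons, asum_cons]; abel
    rw [hsplit, List.length_cons, Nat.cast_succ]
    refine (norm_add_le _ _).trans ((add_le_add h1 ((norm_add_le _ _).trans (add_le_add h2 ih))).trans ?_)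
    have hw : (0 : ℝ) ≤ w.length := Nat.cast_nonneg _
    nlinarith [mul_nonneg hε0 ha0, mul_nonneg (mul_nonneg hw hε0) ha0]

end Rotated

/-! ## §3 The main term (125) against the flat one: `‖(Q₀(V₀)A)_c − (Q₀(1)A)_c‖ ≤ 2(d+1)L·ε_U·|A|` -/

section MainTerm

variable [NormedAlgebra ℂ 𝔸] (L : ℕ) {V : Site d → Fin d → 𝔸ˣ} (hV : ∀ x κ, V x κ ∈ U1 𝔸) {εU : ℝ} (hU : ∀ x κ, ‖(V x κ : 𝔸) - 1‖ ≤ εU)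
  {A : Site d → Fin d → 𝔸} {a : ℝ} (hA : ∀ x κ, ‖A x κ‖ ≤ a)

include hV hU hA in
/-- **The main term (125) is `2(d+1)L·ε_U·|A|`-close to the flat one**: per block point, the rotation `R(V₀(Γ_{c₋,x}))`
(`≤ dL` bonds) of the segment sum (`≤ L|A|`) costs `2dL²ε_U|A|`, the rotated segment sum against the abelian one `L(L+1)ε_U|A|`;
weights `L^{−(d+1)}` over `L^d` points. [cite: Balaban1985Averaging, (125)–(126) p.36] -/
theorem norm_Q0cov_sub_Q0form_le (hL : 1 ≤ L) (q : Site d) (κ : Fin d) :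
    ‖Q0cov L V A q κ - Q0form L A q κ‖ ≤ 2 * (d + 1) * L * εU * a := by
  have hLpos : (0 : ℝ) < L := by exact_mod_cast hL
  have hL1 : (1 : ℝ) ≤ L := by exact_mod_cast hL
  have hε0 : 0 ≤ εU := (norm_nonneg _).trans (hU q κ); have ha0 : 0 ≤ a := (norm_nonneg _).trans (hA q κ)
  have hr : ∀ r : Fin d → Fin L,
      ‖conjR (hol V q (treeWord (boxVec L r))) (tsum V A (q + boxVec L r) (seg κ L))
          - asum A (q + boxVec L r) (seg κ L)‖ ≤ (2 * d * L * L + L * (L + 1)) * εU * a := by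
    intro r
    set h : 𝔸ˣ := hol V q (treeWord (boxVec L r))
    set T : 𝔸 := tsum V A (q + boxVec L r) (seg κ L)
    have hh : ‖(h : 𝔸) - 1‖ ≤ d * L * εU := by
      refine (norm_hol_sub_one_le hV hU q _).trans ?_
      rw [length_treeWord]
      exact mul_le_mul_of_nonneg_right (by exact_mod_cast l1_boxVec_le L r) hε0
    have hT : ‖T‖ ≤ L * a := by
      have := norm_tsum_le hV hA (q + boxVec L r) (seg κ L)
      rwa [length_seg, Int.natAbs_natCast] at this
    have h1 : ‖conjR h T - T‖ ≤ 2 * (d * L * εU) * ‖T‖ := norm_conjR_sub_self_le (hol_mem hV _ _) hh T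
    have h2 : ‖T - asum A (q + boxVec L r) (seg κ L)‖ ≤ L * (L + 1) * εU * a := by
      have := norm_tsum_sub_asum_le hV hU hA (q + boxVec L r) (seg κ L)
      rwa [length_seg, Int.natAbs_natCast] at this
    calc ‖conjR h T - asum A (q + boxVec L r) (seg κ L)‖
        ≤ ‖conjR h T - T‖ + ‖T - asum A (q + boxVec L r) (seg κ L)‖ := norm_sub_le_norm_sub_add_norm_sub _ _ _
      _ ≤ 2 * (d * L * εU) * (L * a) + L * (L + 1) * εU * a :=
          add_le_add (h1.trans (mul_le_mul_of_nonneg_left hT (by positivity))) h2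
      _ = (2 * d * L * L + L * (L + 1)) * εU * a := by ring
  unfold Q0cov Q0form
  rw [← Finset.sum_sub_distrib]
  simp_rw [← smul_sub]
  calc ‖∑ r : Fin d → Fin L, (((L : ℝ) ^ (d + 1))⁻¹) •
          (conjR (hol V q (treeWord (boxVec L r))) (tsum V A (q + boxVec L r) (seg κ L))
            - asum A (q + boxVec L r) (seg κ L))‖
      ≤ ∑ _r : Fin d → Fin L, (((L : ℝ) ^ (d + 1))⁻¹) * ((2 * d * L * L + L * (L + 1)) * εU * a) := by
        refine norm_sum_le_of_le _ fun r _ => ?_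
        rw [norm_smul, Real.norm_of_nonneg (by positivity)]
        exact mul_le_mul_of_nonneg_left (hr r) (by positivity)
    _ = (2 * d * L + (L + 1)) * εU * a := by
        rw [Finset.sum_const, Finset.card_univ, Fintype.card_pi, Finset.prod_const, Finset.card_univ,
          Fintype.card_fin, Fintype.card_fin, nsmul_eq_mul, Nat.cast_pow, pow_succ]
        field_simp
    _ ≤ 2 * (d + 1) * L * εU * a :=
        mul_le_mul_of_nonneg_right (mul_le_mul_of_nonneg_right (by nlinarith [(Nat.cast_nonneg d : (0 : ℝ) ≤ d)]) hε0) ha0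

end MainTerm

/-! ## §4 The linear part (122)/(124) against the flat one: `‖L(Q(V₀)A)_c − L(Q(1)A)_c‖ ≤ (50(d+1)ε + 2(d+1)Lε_U)·L·|A|` -/

section LinearPart

variable [NormedAlgebra ℂ 𝔸] [CompleteSpace 𝔸] (L : ℕ) {V : Site d → Fin d → 𝔸ˣ} (hV : ∀ x κ, V x κ ∈ U1 𝔸) {εU : ℝ} (hU : ∀ x κ, ‖(V x κ : 𝔸) - 1‖ ≤ εU)
  {A : Site d → Fin d → 𝔸} {a : ℝ} (ha : 0 ≤ a) (hA : ∀ x κ, ‖A x κ‖ ≤ a) (hL : 1 ≤ L) (q : Site d) (κ : Fin d)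

include ha hA hL in
/-- **At the flat background the linear part IS `L` times the main term**: «L(Q(1)A)_c» `= linQ = L·(Q₀A)_c` (lit-balaban's
`linQcov_one_left` + `linQ_eq_smul_Q0form`; the three defect brackets of (124) vanish at `V₀ = 1`). [cite: Balaban1985Averaging, (124)–(125) p.36] -/
theorem linQcov_one_eq_smul_Q0form :
    linQcov L (1 : Site d → Fin d → 𝔸ˣ) A q κ = (L : ℝ) • Q0form L A q κ := by
  rw [linQcov_one_left L hL A ha hA q κ, linQ_eq_smul_Q0form L hL]

include hV hU ha hA hL in
/-- **THE ONE-STEP LINEARISED AVERAGING IS LIPSCHITZ IN ITS BACKGROUND AT `V₀ = 1` (two displayed letters).**  For a `U1` background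
`V₀` whose block loops at `c` satisfy `‖W_{c,x}(V₀) − 1‖ ≤ ε ≤ 1∕8` and whose bond variables satisfy `‖V₀(b) − 1‖ ≤ ε_U`, and `|A_b| ≤ a`:
`‖L(Q(V₀)A)_c − L(Q(1)A)_c‖ ≤ (50(d+1)ε + 2(d+1)Lε_U)·L·a` — (126)'s defect brackets (`B7Prop3GeneralLinearBound.norm_linQcov_sub_main_le`,
`50(d+1)εLa` — print's remainder `Q″(V₀)` of (139), with the global sup in place of the two-block average `Q″|A|` of (140)) plus the main
term `Q_{V₀}` against the flat one (§3, `2(d+1)Lε_U a`, times the normalisation `L`).  Explicit, `L`-dependent constants (print's (3.79) ∕ (139):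
«depends only on d and L»), at `V = 1`. [cite: Balaban1985Averaging, (124)–(126) p.36, (139)–(140) p.39; Balaban1985BackgroundPropagators, (3.79) p.406] -/
theorem norm_linQcov_sub_flat_le {ε : ℝ} (hε0 : 0 ≤ ε) (hε : ε ≤ 1 / 8)
    (hW : ∀ r : Fin d → Fin L, ‖((Wcx L V q κ (boxVec L r) : 𝔸ˣ) : 𝔸) - 1‖ ≤ ε) :
    ‖linQcov L V A q κ - linQcov L (1 : Site d → Fin d → 𝔸ˣ) A q κ‖ ≤ (50 * (d + 1) * ε + 2 * (d + 1) * L * εU) * (L * a) := by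
  have h1 := norm_linQcov_sub_main_le L hV ha hA hL q κ hε0 hε hW
  have h2 := norm_Q0cov_sub_Q0form_le L hV hU hA hL q κ
  have h3 : ‖(L : ℝ) • Q0cov L V A q κ - (L : ℝ) • Q0form L A q κ‖ ≤ L * (2 * (d + 1) * L * εU * a) := by
    rw [← smul_sub, norm_smul, Real.norm_of_nonneg (Nat.cast_nonneg L)]
    exact mul_le_mul_of_nonneg_left h2 (Nat.cast_nonneg L)
  rw [linQcov_one_eq_smul_Q0form L ha hA hL q κ]
  calc ‖linQcov L V A q κ - (L : ℝ) • Q0form L A q κ‖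
      ≤ ‖linQcov L V A q κ - (L : ℝ) • Q0cov L V A q κ‖ + ‖(L : ℝ) • Q0cov L V A q κ - (L : ℝ) • Q0form L A q κ‖ :=
        norm_sub_le_norm_sub_add_norm_sub _ _ _
    _ ≤ 50 * (d + 1) * ε * L * a + L * (2 * (d + 1) * L * εU * a) := add_le_add h1 h3
    _ = (50 * (d + 1) * ε + 2 * (d + 1) * L * εU) * (L * a) := by ring

include hV hU ha hA hL in
/-- **… (one displayed letter `ε_U`, no smallness)**: when the block loops at `c` are `α`-regular for some `α ≤ 1∕64` (the letter the
tree's `linQAt`∕`QtorusLin` carry anyway), the loop letter can be taken `min(α, 2(d+1)Lε_U)` (§1 `norm_Wcx_sub_one_le`), whence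
`‖L(Q(V₀)A)_c − L(Q(1)A)_c‖ ≤ 102(d+1)²·L·ε_U·(L·a)` for EVERY `ε_U ≥ sup_b ‖V₀(b) − 1‖` — the Lipschitz modulus vanishes as `V₀ → 1`.
[cite: Balaban1985Averaging, (124)–(126) p.36; Balaban1985BackgroundPropagators, (3.79) p.406] -/
theorem norm_linQcov_sub_flat_le_of_bonds {α : ℝ} (hα1 : α ≤ 1 / 64)
    (hWα : ∀ r : Fin d → Fin L, ‖((Wcx L V q κ (boxVec L r) : 𝔸ˣ) : 𝔸) - 1‖ ≤ α) (hεU : 0 ≤ εU) :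
    ‖linQcov L V A q κ - linQcov L (1 : Site d → Fin d → 𝔸ˣ) A q κ‖ ≤ 102 * (d + 1) ^ 2 * L * εU * (L * a) := by
  have hα0 : 0 ≤ α := (norm_nonneg _).trans (hWα fun _ => ⟨0, hL⟩)
  have hd : (0 : ℝ) ≤ d := Nat.cast_nonneg d
  have hL0 : (0 : ℝ) ≤ L := Nat.cast_nonneg L
  set ε : ℝ := min α (2 * (d + 1) * L * εU) with hε_def
  have hWε : ∀ r : Fin d → Fin L, ‖((Wcx L V q κ (boxVec L r) : 𝔸ˣ) : 𝔸) - 1‖ ≤ ε := fun r =>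
    le_min (hWα r) (norm_Wcx_sub_one_le hV hU L q κ r hεU)
  have hε0 : 0 ≤ ε := le_min hα0 (by positivity)
  have hε8 : ε ≤ 1 / 8 := (min_le_left _ _).trans (hα1.trans (by norm_num))
  have hεb : ε ≤ 2 * (d + 1) * L * εU := min_le_right _ _
  refine (norm_linQcov_sub_flat_le L hV hU ha hA hL q κ hε0 hε8 hWε).trans (mul_le_mul_of_nonneg_right ?_ (mul_nonneg hL0 ha))
  nlinarith [mul_nonneg (mul_nonneg hd hL0) hεU, mul_nonneg hL0 hεU]

end LinearPart

/-! ## §5 On the torus: `Q(U)` of [B9] (3.15) (`B9Eq315QTorus.QtorusLin`) against `Q(1)`; §6 on the weighted `L²` carriers -/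

section Torus

open B4Sect5Torus (TSite)
open B9SectCLatticeCarrier (Bond)
open B9Eq319QprimeTorus (fineP)
open B9Eq311L2Pairing (WL2)
open B11Eq103H1Complex (BondL2K)
open B9Eq315QTorus (perCfg perSite cornerSite QtorusLin QtorusLin_apply QtorusW QtorusW_apply)

variable [NormedAlgebra ℂ 𝔸] [CompleteSpace 𝔸] (L : ℕ) (m : Fin d → ℕ) [∀ i, NeZero (fineP L m i)] (hL : 1 ≤ L)
  (U : Bond d (fineP L m) → 𝔸ˣ) {α : ℝ} (hα1 : α ≤ 1 / 64)
  (hU1 : ∀ (x : Site d) (κ : Fin d), perCfg (fineP L m) U x κ ∈ U1 𝔸)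
  (hreg : ∀ (y : TSite d m) (κ : Fin d) (r : Fin d → Fin L),
    ‖((Wcx L (perCfg (fineP L m) U) (cornerSite L y) κ (boxVec L r) : 𝔸ˣ) : 𝔸) - 1‖ ≤ α)
  {α' : ℝ} (hα1' : α' ≤ 1 / 64)
  (hU1' : ∀ (x : Site d) (κ : Fin d), perCfg (fineP L m) (fun _ : Bond d (fineP L m) => (1 : 𝔸ˣ)) x κ ∈ U1 𝔸)
  (hreg' : ∀ (y : TSite d m) (κ : Fin d) (r : Fin d → Fin L),
    ‖((Wcx L (perCfg (fineP L m) (fun _ : Bond d (fineP L m) => (1 : 𝔸ˣ))) (cornerSite L y) κ (boxVec L r) : 𝔸ˣ) : 𝔸) - 1‖ ≤ α')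
  {εU : ℝ} (hεU : 0 ≤ εU) (hUε : ∀ b : Bond d (fineP L m), ‖(U b : 𝔸) - 1‖ ≤ εU)

omit [NormOneClass 𝔸] [NormedAlgebra ℂ 𝔸] [CompleteSpace 𝔸] in
/-- The periodic extension of the flat torus background is the flat background of `ℤ^d`. [cite: Balaban1985Averaging, (1) p.17] -/
theorem perCfg_const_one : perCfg (fineP L m) (fun _ : Bond d (fineP L m) => (1 : 𝔸ˣ)) = (1 : Site d → Fin d → 𝔸ˣ) := rfl

include hεU hUε in
/-- **`Q(U)` ON THE TORUS IS LIPSCHITZ IN `U` AT THE FLAT BACKGROUND** (per coarse bond, sup norm on the fine bonds): for EVERY admissible set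
of regularity letters on either side (`QtorusLin`'s value does not depend on them), `‖(Q(U)A)(c) − (Q(1)A)(c)‖ ≤ 102(d+1)²·L·ε_U·sup_b ‖A(b)‖`
with `ε_U ≥ sup_b ‖U(b) − 1‖` — §4 on the periodic extensions (`QtorusLin_apply` = `L⁻¹ •` «L(Q(Ũ)Ã)_c»).  The `δ_Q`-letter of the NE9
chain's planned small-field coercivity (`‖Q(U)x − Q(1)x‖ ≤ δ_Q‖x‖`), finite-lattice constants.
[cite: Balaban1985BackgroundPropagators, (3.15) p.393, (3.78)–(3.79) p.406; Balaban1985Averaging, (124)–(126) p.36] -/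
theorem norm_QtorusLin_sub_flat_le (A : Bond d (fineP L m) → 𝔸) {a : ℝ} (hA : ∀ b, ‖A b‖ ≤ a) (c : Bond d m) :
    ‖QtorusLin L m hL U hα1 hU1 hreg A c - QtorusLin L m hL (fun _ => 1) hα1' hU1' hreg' A c‖
      ≤ 102 * (d + 1) ^ 2 * L * εU * a := by
  have hLpos : (0 : ℝ) < L := by exact_mod_cast hL
  have ha : 0 ≤ a := (norm_nonneg _).trans (hA (perSite (fineP L m) 0, c.2))
  have hAp : ∀ (x : Site d) (κ : Fin d), ‖perCfg (fineP L m) A x κ‖ ≤ a := fun x κ => hA _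
  have hUp : ∀ (x : Site d) (κ : Fin d), ‖((perCfg (fineP L m) U x κ : 𝔸ˣ) : 𝔸) - 1‖ ≤ εU := fun x κ => hUε _
  have h := norm_linQcov_sub_flat_le_of_bonds L hU1 hUp ha hAp hL (cornerSite L c.1) c.2 hα1 (hreg c.1 c.2) hεU
  rw [QtorusLin_apply, QtorusLin_apply, ← smul_sub, norm_smul, norm_inv, Complex.norm_natCast, perCfg_const_one,
    inv_mul_le_iff₀ hLpos]
  exact h.trans (le_of_eq (by ring))

/-! ## §6 On the chain's weighted `L²` carriers: `QtorusW φ U` against `QtorusW φ 1` -/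

/-- Pointwise control by the weighted `L²` norm with a constant weight: `‖f(x)‖ ≤ ‖f‖∕√c₀`. [cite: Balaban1985BackgroundPropagators, (3.11) p.392] -/
theorem norm_apply_le_of_WL2 {X : Type*} [Fintype X] {V : Type*} [NormedAddCommGroup V] [InnerProductSpace ℂ V] {c₀ : ℝ}
    [Fact (0 < c₀)] (f : WL2 ℂ (fun _ : X => c₀) V) (x : X) : ‖WL2.equiv ℂ _ V f x‖ ≤ ‖f‖ / Real.sqrt c₀ := by
  have hc : 0 < c₀ := Fact.out
  have hs : 0 < Real.sqrt c₀ := Real.sqrt_pos.2 hc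
  rw [le_div_iff₀ hs]
  have h := WL2.weight_mul_norm_sq_apply_le f x
  have h' : (‖WL2.equiv ℂ _ V f x‖ * Real.sqrt c₀) ^ 2 ≤ ‖f‖ ^ 2 := by
    rw [mul_pow, Real.sq_sqrt hc.le, mul_comm]; exact h
  have h0 : 0 ≤ ‖WL2.equiv ℂ _ V f x‖ * Real.sqrt c₀ := mul_nonneg (norm_nonneg _) hs.le
  calc ‖WL2.equiv ℂ _ V f x‖ * Real.sqrt c₀ = Real.sqrt ((‖WL2.equiv ℂ _ V f x‖ * Real.sqrt c₀) ^ 2) := (Real.sqrt_sq h0).symm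
    _ ≤ Real.sqrt (‖f‖ ^ 2) := Real.sqrt_le_sqrt h'
    _ = ‖f‖ := Real.sqrt_sq (norm_nonneg f)

/-- The weighted `L²` norm from a pointwise bound: `‖g‖ ≤ √(c₁·|X|)·B` if every `‖g(x)‖ ≤ B`. [cite: Balaban1985BackgroundPropagators, (3.11) p.392] -/
theorem norm_WL2_le_of_pointwise {X : Type*} [Fintype X] {V : Type*} [NormedAddCommGroup V] [InnerProductSpace ℂ V] {c₁ : ℝ}
    [Fact (0 < c₁)] (g : WL2 ℂ (fun _ : X => c₁) V) {B : ℝ} (hB0 : 0 ≤ B) (hB : ∀ x, ‖WL2.equiv ℂ _ V g x‖ ≤ B) :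
    ‖g‖ ≤ Real.sqrt (c₁ * Fintype.card X) * B := by
  have hc : 0 < c₁ := Fact.out
  have hsq : ‖g‖ ^ 2 ≤ (Real.sqrt (c₁ * Fintype.card X) * B) ^ 2 := by
    rw [WL2.norm_sq, mul_pow, Real.sq_sqrt (by positivity)]
    calc ∑ x, c₁ * ‖WL2.equiv ℂ _ V g x‖ ^ 2 ≤ ∑ _x : X, c₁ * B ^ 2 :=
          Finset.sum_le_sum fun x _ => mul_le_mul_of_nonneg_left
            (pow_le_pow_left₀ (norm_nonneg _) (hB x) 2) hc.le
      _ = c₁ * Fintype.card X * B ^ 2 := by rw [Finset.sum_const, Finset.card_univ, nsmul_eq_mul]; ring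
  have h0 : 0 ≤ Real.sqrt (c₁ * Fintype.card X) * B := mul_nonneg (Real.sqrt_nonneg _) hB0
  calc ‖g‖ = Real.sqrt (‖g‖ ^ 2) := (Real.sqrt_sq (norm_nonneg g)).symm
    _ ≤ Real.sqrt ((Real.sqrt (c₁ * Fintype.card X) * B) ^ 2) := Real.sqrt_le_sqrt hsq
    _ = Real.sqrt (c₁ * Fintype.card X) * B := Real.sqrt_sq h0

variable {W : Type*} [NormedAddCommGroup W] [InnerProductSpace ℂ W] (φ : W ≃ₗ[ℂ] 𝔸) {c₀ c₁ : ℝ} [Fact (0 < c₀)] [Fact (0 < c₁)]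
  {Mφ Mφ' : ℝ} (hMφ : 0 ≤ Mφ) (hφ : ∀ w, ‖φ w‖ ≤ Mφ * ‖w‖) (hMφ' : 0 ≤ Mφ') (hφ' : ∀ X, ‖φ.symm X‖ ≤ Mφ' * ‖X‖)

include hεU hUε hMφ hφ hMφ' hφ' in
/-- **THE `δ_Q`-LETTER ON THE NE9 CHAIN'S CARRIERS**: `Q(U)` read on the weighted `L²` spaces of `W`-valued bond functions (fibre along `φ`,
fine weight `c₀`, coarse weight `c₁`; `B9Eq315QTorus.QtorusW`) is Lipschitz in the background at `U = 1`:
`‖Q(U)f − Q(1)f‖ ≤ M_φ′·M_φ·√(c₁·|bonds of T^{(1)}|∕c₀)·102(d+1)²L·ε_U·‖f‖` for `ε_U ≥ sup_b ‖U(b) − 1‖`, `‖φw‖ ≤ M_φ‖w‖`, `‖φ⁻¹X‖ ≤ M_φ′‖X‖`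
— §5 at the `𝔸`-valued function `b ↦ φ(f(b))` (sup `≤ M_φ‖f‖∕√c₀`), read back along `φ⁻¹` and summed with the coarse weight.  Finite-lattice constants
(non-uniform in `L`, `m`); the displayed `hnear`-ingredient of `B5Eq172FlatCoercivity.exists_coercive_principal_of_near_flat` for the `aQ*Q` term.
[cite: Balaban1985BackgroundPropagators, (3.15)–(3.16) p.393, (3.78)–(3.79) p.406, (3.82) p.407, Thm 3.11 p.416; Balaban1985Averaging, (124)–(126) p.36] -/
theorem norm_QtorusW_sub_flat_le (f : BondL2K ℂ d (fineP L m) c₀ W) :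
    ‖QtorusW L m hL φ U hα1 hU1 hreg (c₁ := c₁) f - QtorusW L m hL φ (fun _ => 1) hα1' hU1' hreg' (c₁ := c₁) f‖
      ≤ Mφ' * Mφ * Real.sqrt (c₁ * Fintype.card (Bond d m) / c₀) * (102 * (d + 1) ^ 2 * L * εU) * ‖f‖ := by
  have hc₀ : 0 < c₀ := Fact.out
  set g : Bond d (fineP L m) → 𝔸 := fun b => φ (WL2.equiv ℂ _ W f b) with hg
  set a : ℝ := Mφ * (‖f‖ / Real.sqrt c₀) with ha_def
  have ha0 : 0 ≤ a := mul_nonneg hMφ (div_nonneg (norm_nonneg f) (Real.sqrt_nonneg _))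
  have ha : ∀ b, ‖g b‖ ≤ a := fun b => (hφ _).trans (mul_le_mul_of_nonneg_left (norm_apply_le_of_WL2 f b) hMφ)
  have hpt : ∀ c : Bond d m,
      ‖WL2.equiv ℂ _ W (QtorusW L m hL φ U hα1 hU1 hreg (c₁ := c₁) f
          - QtorusW L m hL φ (fun _ => 1) hα1' hU1' hreg' (c₁ := c₁) f) c‖ ≤ Mφ' * (102 * (d + 1) ^ 2 * L * εU * a) := by
    intro c
    rw [WL2.equiv_sub, Pi.sub_apply, QtorusW_apply, QtorusW_apply, ← map_sub]
    exact (hφ' _).trans (mul_le_mul_of_nonneg_left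
      (norm_QtorusLin_sub_flat_le L m hL U hα1 hU1 hreg hα1' hU1' hreg' hεU hUε g ha c) hMφ')
  have hB0 : 0 ≤ Mφ' * (102 * (d + 1) ^ 2 * L * εU * a) := by positivity
  refine (norm_WL2_le_of_pointwise _ hB0 hpt).trans (le_of_eq ?_)
  rw [ha_def, Real.sqrt_div' _ hc₀.le]
  ring

end Torus

end Literature.MathematicalPhysics.QuantumFieldTheory.Balaban1983to89.B9Eq315QLipschitz

end
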